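import Mathlib
import HarnessLib

/-!
# The analytic SEAM of line `heatprofile` for crux `CornerNoDip` (stmt-AtomisticToContinuum-16009, route `HoelderEscapeProfile`)

Pure real analysis over `tsum` (no dynamics, no measure theory): the corner estimate for the fibred Abelian
conductivity from the Abel heating profile of an ABSTRACT family `Sb : ℝ → ℤ → ℝ` (profiles `S̄_ν(x)`),
`S0 : ℤ → ℝ` (static profile), `Ghν : ℝ → ℝ → ℝ` (fibred conductivity `𝒢_ν(k)`) tied by the EXCESS FORM of the
`k`-space conservation law `(2 − 2cos k)·Ghν ν k = ν Σ_x (1 − cos kx)(Sb ν x − S0 x)` and Helfand–Abel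
`Ghν ν 0 = (ν/2) Σ_x x²(Sb ν x − S0 x)`. For `cos k ≠ 1`, `Ghν ν k − Ghν ν 0 = −ν Σ_x K_k(x)(Sb ν x − S0 x)` with
`K_k(x) = x²/2 − (1 − cos kx)/(2 − 2cos k)`, and the lattice Fejér inequality `|sin(xθ)| ≤ |x||sin θ|` (INTEGER `x`)
gives `0 ≤ K_k(x) ≤ x²/2` exactly (`kernel_bounds`): no dip can come from sites where the profile exceeds its static
value, `Ghν ν k − Ghν ν 0 ≤ (ν/2)Σ x²|S0| + (ν/2)Σ x²(Sb ν x)⁻`. `corner_noDip_of_profile` makes the right side `≤ ε`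
eventually in `ν`, uniformly on `|k| ≤ a√ν`, from a sup bound on `Sb` and the smallness of the `ν`-weighted second
moment of the NEGATIVE PART of `Sb ν` on a mesoscopic window (`h3`) and beyond (`h4`). In the crux frame `h1`, `h2`
are the LANDED `Theorems.CornerNoDip.HeatProfile.stub_profileRepresentation` (p161414) / `stub_profileSupBound`
(p159323); the composition with the crux is `HoelderEscapeProfileCornerNoDipSplit.lean`. Lead cycles 1–3 of the line;
helper file `--supports stmt-AtomisticToContinuum-16009`.
-/

noncomputable section

open Filter Topology Set Finset

namespace Summit.AtomisticToContinuum.FouriersLaw.Theorems.CornerNoDip.HeatProfile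

/-- `|sin(n φ)| ≤ n·|sin φ|` for every natural `n` (induction, addition formula); private copy of
`Theorems.DrudeDissolution.KineticPolymerGasOnTheTimeAxis.abs_sin_nat_mul_le` (kept local to avoid a cross-route import). [folklore] -/
private theorem abs_sin_nat_mul_le (n : ℕ) (φ : ℝ) : |Real.sin (n * φ)| ≤ n * |Real.sin φ| := by
  induction n with
  | zero => simp
  | succ n ih =>
    have e : ((n + 1 : ℕ) : ℝ) * φ = n * φ + φ := by push_cast; ring
    rw [e, Real.sin_add]
    have h1 : |Real.sin (n * φ) * Real.cos φ| ≤ |Real.sin (n * φ)| := by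
      rw [abs_mul]
      exact mul_le_of_le_one_right (abs_nonneg _) (Real.abs_cos_le_one _)
    have h2 : |Real.cos (n * φ) * Real.sin φ| ≤ |Real.sin φ| := by
      rw [abs_mul]
      exact mul_le_of_le_one_left (abs_nonneg _) (Real.abs_cos_le_one _)
    calc |Real.sin (n * φ) * Real.cos φ + Real.cos (n * φ) * Real.sin φ|
        ≤ |Real.sin (n * φ) * Real.cos φ| + |Real.cos (n * φ) * Real.sin φ| := abs_add_le _ _
      _ ≤ n * |Real.sin φ| + |Real.sin φ| := add_le_add (h1.trans ih) h2
      _ = ((n + 1 : ℕ) : ℝ) * |Real.sin φ| := by push_cast; ring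

/-- `|sin(x φ)| ≤ |x|·|sin φ|` for every INTEGER `x` — the lattice Fejér inequality. [folklore] -/
theorem abs_sin_int_mul_le (x : ℤ) (φ : ℝ) : |Real.sin (x * φ)| ≤ |(x : ℝ)| * |Real.sin φ| := by
  obtain ⟨n, rfl | rfl⟩ := Int.eq_nat_or_neg x
  · have := abs_sin_nat_mul_le n φ
    simpa using this
  · have := abs_sin_nat_mul_le n φ
    have e : ((-(n : ℤ) : ℤ) : ℝ) * φ = -((n : ℝ) * φ) := by push_cast; ring
    rw [e, Real.sin_neg, abs_neg]
    simpa using this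

/-- `1 − cos(kx) ≤ x²(1 − cos k)` for integer `x`: the Fejér weight `(1 − cos kx)/(2 − 2cos k)` is at
most `x²/2`, with equality at `x = ±1`. [folklore] -/
theorem one_sub_cos_int_mul_le (x : ℤ) (k : ℝ) :
    1 - Real.cos (k * x) ≤ (x : ℝ) ^ 2 * (1 - Real.cos k) := by
  have e1 : 1 - Real.cos (k * x) = 2 * Real.sin (x * (k / 2)) ^ 2 := by
    rw [Real.sin_sq_eq_half_sub]
    have : 2 * (x * (k / 2)) = k * x := by ring
    rw [this]; ring
  have e2 : 1 - Real.cos k = 2 * Real.sin (k / 2) ^ 2 := by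
    rw [Real.sin_sq_eq_half_sub]
    have : 2 * (k / 2) = k := by ring
    rw [this]; ring
  rw [e1, e2]
  have h := abs_sin_int_mul_le x (k / 2)
  have h2 : Real.sin (x * (k / 2)) ^ 2 ≤ (|(x : ℝ)| * |Real.sin (k / 2)|) ^ 2 := by
    rw [← sq_abs (Real.sin (x * (k / 2)))]
    exact pow_le_pow_left₀ (abs_nonneg _) h 2
  rw [mul_pow, sq_abs, sq_abs] at h2
  nlinarith [h2]

/-- The kernel bounds `0 ≤ K_k(x) = x²/2 − (1 − cos kx)/(2 − 2cos k) ≤ x²/2` for `cos k < 1`. [folklore] -/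
theorem kernel_bounds (x : ℤ) {k : ℝ} (hk : Real.cos k < 1) :
    0 ≤ (x : ℝ) ^ 2 / 2 - (1 - Real.cos (k * x)) / (2 - 2 * Real.cos k) ∧
      (x : ℝ) ^ 2 / 2 - (1 - Real.cos (k * x)) / (2 - 2 * Real.cos k) ≤ (x : ℝ) ^ 2 / 2 := by
  have hd : 0 < 2 - 2 * Real.cos k := by linarith
  constructor
  · have h := one_sub_cos_int_mul_le x k
    rw [sub_nonneg, div_le_iff₀ hd]
    nlinarith [h]
  · have h0 : 0 ≤ (1 - Real.cos (k * x)) / (2 - 2 * Real.cos k) :=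
      div_nonneg (by linarith [Real.cos_le_one (k * x)]) hd.le
    linarith

/-- Short-range counting bound: `Σ_{|x| ≤ R} x² f(x) ≤ 3 M R³` for `0 ≤ f ≤ M` and `R ≥ 1`
(the truncated sum is a finite sum over `Icc (-⌊R⌋) ⌊R⌋`, of cardinality `≤ 2R + 1 ≤ 3R`). [folklore] -/
theorem tsum_short_range_le {R M : ℝ} (hR : 1 ≤ R) (hM : 0 ≤ M) (f : ℤ → ℝ)
    (hf0 : ∀ x, 0 ≤ f x) (hfM : ∀ x, f x ≤ M) :
    ∑' x : ℤ, (if |(x : ℝ)| ≤ R then (x : ℝ) ^ 2 * f x else 0) ≤ 3 * M * R ^ 3 := by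
  set s : Finset ℤ := Finset.Icc (-⌊R⌋) ⌊R⌋ with hs
  have hmem : ∀ x : ℤ, |(x : ℝ)| ≤ R → x ∈ s := by
    intro x hx
    rw [abs_le] at hx
    rw [hs, Finset.mem_Icc]
    constructor
    · have h1 : ((-x : ℤ) : ℝ) ≤ R := by push_cast; linarith [hx.1]
      have h2 : -x ≤ ⌊R⌋ := Int.le_floor.mpr h1
      omega
    · exact Int.le_floor.mpr hx.2
  have hzero : ∀ x ∉ s, (if |(x : ℝ)| ≤ R then (x : ℝ) ^ 2 * f x else 0) = 0 := by
    intro x hx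
    rw [if_neg]
    exact fun h => hx (hmem x h)
  rw [tsum_eq_sum hzero]
  have hterm : ∀ x ∈ s, (if |(x : ℝ)| ≤ R then (x : ℝ) ^ 2 * f x else 0) ≤ R ^ 2 * M := by
    intro x _
    split_ifs with hx
    · have hx2 : (x : ℝ) ^ 2 ≤ R ^ 2 := by
        rw [← sq_abs]; exact pow_le_pow_left₀ (abs_nonneg _) hx 2
      exact mul_le_mul hx2 (hfM x) (hf0 x) (by positivity)
    · positivity
  have hcard : (s.card : ℝ) ≤ 2 * R + 1 := by
    rw [hs, Int.card_Icc]
    have hfl : (0 : ℤ) ≤ ⌊R⌋ := Int.floor_nonneg.mpr (by linarith)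
    have hnn : (0 : ℤ) ≤ ⌊R⌋ + 1 - -⌊R⌋ := by omega
    have e : (((⌊R⌋ + 1 - -⌊R⌋).toNat : ℤ) : ℝ) = ((⌊R⌋ + 1 - -⌊R⌋ : ℤ) : ℝ) := by
      exact_mod_cast Int.toNat_of_nonneg hnn
    have e' : ((⌊R⌋ + 1 - -⌊R⌋).toNat : ℝ) = ((⌊R⌋ + 1 - -⌊R⌋ : ℤ) : ℝ) := by
      rw [← e]; norm_cast
    rw [e']
    push_cast
    linarith [Int.floor_le R]
  calc ∑ x ∈ s, (if |(x : ℝ)| ≤ R then (x : ℝ) ^ 2 * f x else 0)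
      ≤ ∑ x ∈ s, R ^ 2 * M := Finset.sum_le_sum hterm
    _ = s.card * (R ^ 2 * M) := by rw [Finset.sum_const, nsmul_eq_mul]
    _ ≤ (2 * R + 1) * (R ^ 2 * M) := mul_le_mul_of_nonneg_right hcard (by positivity)
    _ ≤ 3 * R * (R ^ 2 * M) := mul_le_mul_of_nonneg_right (by linarith) (by positivity)
    _ = 3 * M * R ^ 3 := by ring

/-- Eventual smallness of `C·ν^q` as `ν ↓ 0` (`q > 0`), in the `∃ ν₀` form used by the stubs. [folklore] -/
theorem exists_rpow_small {q C ε : ℝ} (hq : 0 < q) (hε : 0 < ε) :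
    ∃ ν₀ : ℝ, 0 < ν₀ ∧ ∀ ν : ℝ, 0 < ν → ν ≤ ν₀ → C * ν ^ q ≤ ε := by
  have hc : ContinuousAt (fun ν : ℝ => C * ν ^ q) 0 :=
    continuousAt_const.mul (Real.continuousAt_rpow_const 0 q (Or.inr hq.le))
  have h0 : (fun ν : ℝ => C * ν ^ q) 0 = 0 := by simp [Real.zero_rpow hq.ne']
  have hev : ∀ᶠ ν in 𝓝 (0 : ℝ), C * ν ^ q < ε :=
    hc.eventually (gt_mem_nhds (show (fun ν : ℝ => C * ν ^ q) 0 < ε by rw [h0]; exact hε))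
  obtain ⟨δ, hδ, hball⟩ := Metric.eventually_nhds_iff.mp hev
  refine ⟨δ / 2, by positivity, fun ν hν hνle => le_of_lt (hball ?_)⟩
  rw [Real.dist_eq, sub_zero, abs_of_pos hν]
  linarith

/-! ### The analytic seam (proved): the corner estimate from the Abel heating profile of an abstract family -/

/-- **Corner estimate, abstract form.** Under the representation hypotheses `h1` (weighted summability of
`Sb ν`, excess conservation law, Helfand–Abel), `h1s` (`Σ(1+x²)|S0| < ∞`), a uniform sup bound `h2`, and the
smallness of the `ν`-weighted negative second moment of `Sb ν` on the window `ν^{-θ} < |x| ≤ L/√ν`, `θ < 1/3`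
(`h3`) and beyond `|x|√ν > L` (`h4`): for every `a, ε > 0`, eventually in `ν`, `Ghν ν k ≤ Ghν ν 0 + ε` on
`|k| ≤ a√ν` (deviation `≤ (ν/2)Σ x²|S0| + (ν/2)Σ x²(Sb ν x)⁻`, short range by counting). [folklore] -/
theorem corner_noDip_of_profile :
    ∀ (Sb : ℝ → ℤ → ℝ) (S0 : ℤ → ℝ) (Ghν : ℝ → ℝ → ℝ) (a ε : ℝ), 0 < a → 0 < ε →
    (∀ ν : ℝ, 0 < ν → Summable (fun x : ℤ => (1 + (x : ℝ) ^ 2) * |Sb ν x|) ∧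
      (∀ k : ℝ, (2 - 2 * Real.cos k) * Ghν ν k =
        ν * ∑' x : ℤ, (1 - Real.cos (k * (x : ℝ))) * (Sb ν x - S0 x)) ∧
      Ghν ν 0 = ν / 2 * ∑' x : ℤ, (x : ℝ) ^ 2 * (Sb ν x - S0 x)) →
    Summable (fun x : ℤ => (1 + (x : ℝ) ^ 2) * |S0 x|) →
    (∃ M : ℝ, ∀ ν : ℝ, 0 < ν → ∀ x : ℤ, |Sb ν x| ≤ M) →
    (∃ θ : ℝ, 0 < θ ∧ θ < 1 / 3 ∧ ∀ L : ℝ, 0 < L → ∀ ε : ℝ, 0 < ε → ∃ ν₀ : ℝ, 0 < ν₀ ∧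
      ∀ ν : ℝ, 0 < ν → ν ≤ ν₀ →
        ν * (∑' x : ℤ, (if ν ^ (-θ) < |(x : ℝ)| ∧ |(x : ℝ)| * Real.sqrt ν ≤ L
          then (x : ℝ) ^ 2 * max (-(Sb ν x)) 0 else 0)) ≤ ε) →
    (∀ ε : ℝ, 0 < ε → ∃ L : ℝ, 0 < L ∧ ∃ ν₀ : ℝ, 0 < ν₀ ∧ ∀ ν : ℝ, 0 < ν → ν ≤ ν₀ →
      ν * (∑' x : ℤ, (if L < |(x : ℝ)| * Real.sqrt ν then (x : ℝ) ^ 2 * max (-(Sb ν x)) 0 else 0))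
        ≤ ε) →
    ∃ ν₀ : ℝ, 0 < ν₀ ∧ ∀ ν : ℝ, 0 < ν → ν ≤ ν₀ → ∀ k : ℝ, |k| ≤ a * Real.sqrt ν →
      Ghν ν k ≤ Ghν ν 0 + ε := by
  intro Sb S0 Ghν a ε ha hε h1 h1s h2 h3 h4
  -- constants
  obtain ⟨M, hM⟩ := h2
  have hM0 : 0 ≤ M := (abs_nonneg _).trans (hM 1 one_pos 0)
  obtain ⟨θ, hθ0, hθ3, h3⟩ := h3
  obtain ⟨L, hL, ν₄, hν₄, h4⟩ := h4 (ε / 4) (by positivity)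
  obtain ⟨ν₃, hν₃, h3⟩ := h3 L hL (ε / 4) (by positivity)
  set Cs : ℝ := ∑' x : ℤ, (1 + (x : ℝ) ^ 2) * |S0 x| with hCs
  have hCs0 : 0 ≤ Cs := tsum_nonneg fun x => by positivity
  -- short range: (ν/2)·3 M ν^{-3θ} ≤ ε/4 eventually
  obtain ⟨ν₂, hν₂, h2s⟩ := exists_rpow_small (q := 1 - 3 * θ) (C := 3 * M / 2) (ε := ε / 4)
    (by linarith) (by positivity)
  set ν₅ : ℝ := ε / (2 * Cs + 1) with hν₅
  have hν₅p : 0 < ν₅ := by positivity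
  set ν₆ : ℝ := (Real.pi / a) ^ 2 with hν₆
  have hν₆p : 0 < ν₆ := by positivity
  refine ⟨min (min (min ν₂ ν₃) (min ν₄ ν₅)) (min ν₆ 1), by positivity, ?_⟩
  intro ν hν hνle k hk
  have hν2 : ν ≤ ν₂ := hνle.trans ((min_le_left _ _).trans ((min_le_left _ _).trans (min_le_left _ _)))
  have hν3 : ν ≤ ν₃ := hνle.trans ((min_le_left _ _).trans ((min_le_left _ _).trans (min_le_right _ _)))
  have hν4 : ν ≤ ν₄ := hνle.trans ((min_le_left _ _).trans ((min_le_right _ _).trans (min_le_left _ _)))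
  have hν5 : ν ≤ ν₅ := hνle.trans ((min_le_left _ _).trans ((min_le_right _ _).trans (min_le_right _ _)))
  have hν6 : ν ≤ ν₆ := hνle.trans ((min_le_right _ _).trans (min_le_left _ _))
  have hν1 : ν ≤ 1 := hνle.trans ((min_le_right _ _).trans (min_le_right _ _))
  -- |k| ≤ π
  have hkπ : |k| ≤ Real.pi := by
    have hs : Real.sqrt ν ≤ Real.pi / a := by
      rw [← Real.sqrt_sq (by positivity : (0 : ℝ) ≤ Real.pi / a)]
      exact Real.sqrt_le_sqrt (by rw [← hν₆]; exact hν6)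
    calc |k| ≤ a * Real.sqrt ν := hk
      _ ≤ a * (Real.pi / a) := mul_le_mul_of_nonneg_left hs ha.le
      _ = Real.pi := by field_simp
  -- the case k = 0 is trivial
  rcases eq_or_ne k 0 with rfl | hk0
  · linarith
  -- cos k < 1
  have hcos : Real.cos k < 1 := by
    rcases (Real.cos_le_one k).lt_or_eq with h | h
    · exact h
    · exfalso
      obtain ⟨n, hn⟩ := (Real.cos_eq_one_iff k).mp h
      rcases eq_or_ne n 0 with rfl | hn0
      · simp at hn; exact hk0 hn.symm
      · have h1 : (1 : ℝ) ≤ |(n : ℝ)| := by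
          rw [← Int.cast_abs]; exact_mod_cast Int.one_le_abs hn0
        have h2 : |k| = |(n : ℝ)| * (2 * Real.pi) := by
          rw [← hn, abs_mul, abs_of_pos (by positivity : (0 : ℝ) < 2 * Real.pi)]
        have h3 : 2 * Real.pi ≤ |k| := by
          rw [h2]; nlinarith [Real.pi_pos]
        linarith [Real.pi_pos]
  have hd : 0 < 2 - 2 * Real.cos k := by linarith
  obtain ⟨hSum, hrep, hzero⟩ := h1 ν hν
  -- the excess profile and its summability
  have hmaj : Summable fun x : ℤ => (1 + (x : ℝ) ^ 2) * (|Sb ν x| + |S0 x|) := by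
    have := hSum.add h1s
    refine this.congr fun x => ?_
    ring
  have hdom : ∀ (c : ℝ) {g : ℤ → ℝ},
      (∀ x, |g x| ≤ c * ((1 + (x : ℝ) ^ 2) * (|Sb ν x| + |S0 x|))) → Summable g :=
    fun c g hg => Summable.of_norm_bounded (hmaj.mul_left c)
      (fun x => by simpa only [Real.norm_eq_abs] using hg x)
  have hx2le : ∀ x : ℤ, (x : ℝ) ^ 2 ≤ 1 + (x : ℝ) ^ 2 := fun x => by linarith
  have h1le : ∀ x : ℤ, (1 : ℝ) ≤ 1 + (x : ℝ) ^ 2 := fun x => by nlinarith [sq_nonneg (x : ℝ)]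
  have hEabs : ∀ x : ℤ, |Sb ν x - S0 x| ≤ |Sb ν x| + |S0 x| := fun x => abs_sub _ _
  have hSS0 : ∀ x, 0 ≤ |Sb ν x| + |S0 x| := fun x => by positivity
  -- summable pieces
  have hsE2 : Summable fun x : ℤ => (x : ℝ) ^ 2 * (Sb ν x - S0 x) := hdom 1 fun x => by
    rw [abs_mul, abs_of_nonneg (sq_nonneg _), one_mul]
    exact mul_le_mul (hx2le x) (hEabs x) (abs_nonneg _) (by positivity)
  have hc02 : ∀ x : ℤ, 0 ≤ 1 - Real.cos (k * (x : ℝ)) ∧ 1 - Real.cos (k * (x : ℝ)) ≤ 2 := fun x =>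
    ⟨by linarith [Real.cos_le_one (k * (x : ℝ))], by linarith [Real.neg_one_le_cos (k * (x : ℝ))]⟩
  have hsEc : Summable fun x : ℤ => (1 - Real.cos (k * (x : ℝ))) * (Sb ν x - S0 x) :=
    hdom 2 fun x => by
    rw [abs_mul, abs_of_nonneg (hc02 x).1]
    calc (1 - Real.cos (k * (x : ℝ))) * |Sb ν x - S0 x| ≤ 2 * (|Sb ν x| + |S0 x|) :=
          mul_le_mul (hc02 x).2 (hEabs x) (abs_nonneg _) (by norm_num)
      _ = 2 * (1 * (|Sb ν x| + |S0 x|)) := by ring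
      _ ≤ 2 * ((1 + (x : ℝ) ^ 2) * (|Sb ν x| + |S0 x|)) :=
          mul_le_mul_of_nonneg_left (mul_le_mul_of_nonneg_right (h1le x) (hSS0 x)) (by norm_num)
  -- negative part
  obtain ⟨P, hPdef⟩ : ∃ P : ℤ → ℝ, ∀ x, P x = max (-(Sb ν x)) 0 := ⟨_, fun x => rfl⟩
  have hP0 : ∀ x, 0 ≤ P x := fun x => by rw [hPdef]; exact le_max_right _ _
  have hPle : ∀ x, P x ≤ |Sb ν x| := fun x => by
    rw [hPdef]; exact max_le (neg_le_abs _) (abs_nonneg _)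
  have hPM : ∀ x, P x ≤ M := fun x => (hPle x).trans (hM ν hν x)
  have hnegle : ∀ x, -(Sb ν x) ≤ P x := fun x => by rw [hPdef]; exact le_max_left _ _
  -- the three ranges
  set R : ℝ := ν ^ (-θ) with hRdef
  have hR1 : 1 ≤ R := Real.one_le_rpow_of_pos_of_le_one_of_nonpos hν hν1 (by linarith)
  set fS : ℤ → ℝ := fun x => if |(x : ℝ)| ≤ R then (x : ℝ) ^ 2 * P x else 0 with hfS
  set fM : ℤ → ℝ := fun x => if ν ^ (-θ) < |(x : ℝ)| ∧ |(x : ℝ)| * Real.sqrt ν ≤ L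
    then (x : ℝ) ^ 2 * P x else 0 with hfM
  set fF : ℤ → ℝ := fun x => if L < |(x : ℝ)| * Real.sqrt ν then (x : ℝ) ^ 2 * P x else 0 with hfF
  have hfS0 : ∀ x, 0 ≤ fS x := fun x => by
    simp only [hfS]; split_ifs <;> [exact mul_nonneg (sq_nonneg _) (hP0 x); exact le_rfl]
  have hfM0 : ∀ x, 0 ≤ fM x := fun x => by
    simp only [hfM]; split_ifs <;> [exact mul_nonneg (sq_nonneg _) (hP0 x); exact le_rfl]
  have hfF0 : ∀ x, 0 ≤ fF x := fun x => by
    simp only [hfF]; split_ifs <;> [exact mul_nonneg (sq_nonneg _) (hP0 x); exact le_rfl]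
  have hsplit : ∀ x : ℤ, (x : ℝ) ^ 2 * P x ≤ fS x + fM x + fF x := by
    intro x
    have hxP : 0 ≤ (x : ℝ) ^ 2 * P x := mul_nonneg (sq_nonneg _) (hP0 x)
    by_cases hA : |(x : ℝ)| ≤ R
    · have : fS x = (x : ℝ) ^ 2 * P x := by simp only [hfS, if_pos hA]
      linarith [hfM0 x, hfF0 x]
    · have hA' : ν ^ (-θ) < |(x : ℝ)| := lt_of_not_ge hA
      by_cases hB : |(x : ℝ)| * Real.sqrt ν ≤ L
      · have : fM x = (x : ℝ) ^ 2 * P x := by simp only [hfM, if_pos (And.intro hA' hB)]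
        linarith [hfS0 x, hfF0 x]
      · have : fF x = (x : ℝ) ^ 2 * P x := by simp only [hfF, if_pos (lt_of_not_ge hB)]
        linarith [hfS0 x, hfM0 x]
  -- pointwise domination of the deviation summand
  have hpt : ∀ x : ℤ,
      ((1 - Real.cos (k * (x : ℝ))) / (2 - 2 * Real.cos k) - (x : ℝ) ^ 2 / 2) * (Sb ν x - S0 x) ≤
        1 / 2 * ((x : ℝ) ^ 2 * |S0 x|) + 1 / 2 * (fS x + fM x + fF x) := by
    intro x
    obtain ⟨hK0, hK2⟩ := kernel_bounds x hcos
    set K := (x : ℝ) ^ 2 / 2 - (1 - Real.cos (k * (x : ℝ))) / (2 - 2 * Real.cos k) with hK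
    have e : ((1 - Real.cos (k * (x : ℝ))) / (2 - 2 * Real.cos k) - (x : ℝ) ^ 2 / 2) *
        (Sb ν x - S0 x) = K * (S0 x - Sb ν x) := by rw [hK]; ring
    rw [e]
    have h1 : S0 x - Sb ν x ≤ |S0 x| + P x := by linarith [le_abs_self (S0 x), hnegle x]
    have h2 : 0 ≤ |S0 x| + P x := by linarith [abs_nonneg (S0 x), hP0 x]
    calc K * (S0 x - Sb ν x) ≤ K * (|S0 x| + P x) := mul_le_mul_of_nonneg_left h1 hK0
      _ ≤ (x : ℝ) ^ 2 / 2 * (|S0 x| + P x) := mul_le_mul_of_nonneg_right hK2 h2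
      _ = 1 / 2 * ((x : ℝ) ^ 2 * |S0 x|) + 1 / 2 * ((x : ℝ) ^ 2 * P x) := by ring
      _ ≤ 1 / 2 * ((x : ℝ) ^ 2 * |S0 x|) + 1 / 2 * (fS x + fM x + fF x) := by
          linarith [hsplit x]
  -- summability of everything in sight
  have hsdev : Summable fun x : ℤ =>
      ((1 - Real.cos (k * (x : ℝ))) / (2 - 2 * Real.cos k) - (x : ℝ) ^ 2 / 2) * (Sb ν x - S0 x) :=
    hdom (1 / 2) fun x => by
      obtain ⟨hK0, hK2⟩ := kernel_bounds x hcos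
      have e : |((1 - Real.cos (k * (x : ℝ))) / (2 - 2 * Real.cos k) - (x : ℝ) ^ 2 / 2) *
          (Sb ν x - S0 x)| =
          ((x : ℝ) ^ 2 / 2 - (1 - Real.cos (k * (x : ℝ))) / (2 - 2 * Real.cos k)) * |Sb ν x - S0 x| := by
        rw [abs_mul, abs_sub_comm ((1 - Real.cos (k * (x : ℝ))) / (2 - 2 * Real.cos k)),
          abs_of_nonneg hK0]
      rw [e]
      calc ((x : ℝ) ^ 2 / 2 - (1 - Real.cos (k * (x : ℝ))) / (2 - 2 * Real.cos k)) * |Sb ν x - S0 x|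
          ≤ (x : ℝ) ^ 2 / 2 * (|Sb ν x| + |S0 x|) := mul_le_mul hK2 (hEabs x) (abs_nonneg _) (by positivity)
        _ ≤ 1 / 2 * ((1 + (x : ℝ) ^ 2) * (|Sb ν x| + |S0 x|)) := by nlinarith [hSS0 x, hx2le x]
  have hsS0 : Summable fun x : ℤ => (x : ℝ) ^ 2 * |S0 x| := hdom 1 fun x => by
    rw [abs_mul, abs_of_nonneg (sq_nonneg _), abs_abs, one_mul]
    exact mul_le_mul (hx2le x) (by linarith [abs_nonneg (Sb ν x)]) (abs_nonneg _) (by positivity)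
  have hPdom : ∀ {g : ℤ → ℝ}, (∀ x, 0 ≤ g x) → (∀ x, g x ≤ (x : ℝ) ^ 2 * P x) → Summable g :=
    fun hg0 hgle => hdom 1 fun x => by
      rw [abs_of_nonneg (hg0 x), one_mul]
      calc _ ≤ (x : ℝ) ^ 2 * P x := hgle x
        _ ≤ (1 + (x : ℝ) ^ 2) * (|Sb ν x| + |S0 x|) :=
            mul_le_mul (hx2le x) ((hPle x).trans (by linarith [abs_nonneg (S0 x)])) (hP0 x)
              (by positivity)
  have hxP0 : ∀ x : ℤ, 0 ≤ (x : ℝ) ^ 2 * P x := fun x => mul_nonneg (sq_nonneg _) (hP0 x)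
  have hsfS : Summable fS := hPdom hfS0 fun x => by
    simp only [hfS]; split_ifs <;> [exact le_rfl; exact hxP0 x]
  have hsfM : Summable fM := hPdom hfM0 fun x => by
    simp only [hfM]; split_ifs <;> [exact le_rfl; exact hxP0 x]
  have hsfF : Summable fF := hPdom hfF0 fun x => by
    simp only [hfF]; split_ifs <;> [exact le_rfl; exact hxP0 x]
  -- the four bounds
  have hBstat : ∑' x : ℤ, (x : ℝ) ^ 2 * |S0 x| ≤ Cs :=
    Summable.tsum_le_tsum (fun x => mul_le_mul_of_nonneg_right (hx2le x) (abs_nonneg _)) hsS0 h1s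
  have hBshort : ∑' x : ℤ, fS x ≤ 3 * M * R ^ 3 := tsum_short_range_le hR1 hM0 P hP0 hPM
  have hBmeso : ν * ∑' x : ℤ, fM x ≤ ε / 4 := by
    have := h3 ν hν hν3
    simpa only [hfM, hPdef] using this
  have hBfar : ν * ∑' x : ℤ, fF x ≤ ε / 4 := by
    have := h4 ν hν hν4
    simpa only [hfF, hPdef] using this
  have hBshort' : ν / 2 * (3 * M * R ^ 3) ≤ ε / 4 := by
    have e : ν / 2 * (3 * M * R ^ 3) = 3 * M / 2 * ν ^ (1 - 3 * θ) := by
      have h3' : R ^ 3 = ν ^ (-θ * 3) := by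
        rw [hRdef, ← Real.rpow_natCast, ← Real.rpow_mul hν.le]; norm_num
      have h4' : ν * ν ^ (-θ * 3) = ν ^ (1 - 3 * θ) := by
        conv_lhs => rw [show ν * ν ^ (-θ * 3) = ν ^ (1 : ℝ) * ν ^ (-θ * 3) by rw [Real.rpow_one]]
        rw [← Real.rpow_add hν]; ring_nf
      rw [h3']
      calc ν / 2 * (3 * M * ν ^ (-θ * 3)) = 3 * M / 2 * (ν * ν ^ (-θ * 3)) := by ring
        _ = 3 * M / 2 * ν ^ (1 - 3 * θ) := by rw [h4']
    rw [e]; exact h2s ν hν hν2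
  have hBstat' : ν / 2 * Cs ≤ ε / 4 := by
    have h : ν ≤ ε / (2 * Cs + 1) := hν5
    rw [le_div_iff₀ (by positivity)] at h
    nlinarith [h, hν, hCs0]
  -- summing the domination
  have hsum_le : ∑' x : ℤ, ((1 - Real.cos (k * (x : ℝ))) / (2 - 2 * Real.cos k) - (x : ℝ) ^ 2 / 2) *
      (Sb ν x - S0 x) ≤ 1 / 2 * Cs + 1 / 2 * (3 * M * R ^ 3 + ∑' x : ℤ, fM x + ∑' x : ℤ, fF x) := by
    have hmaj2 : Summable fun x : ℤ => 1 / 2 * ((x : ℝ) ^ 2 * |S0 x|) + 1 / 2 * (fS x + fM x + fF x) :=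
      (hsS0.mul_left _).add (((hsfS.add hsfM).add hsfF).mul_left _)
    calc ∑' x : ℤ, ((1 - Real.cos (k * (x : ℝ))) / (2 - 2 * Real.cos k) - (x : ℝ) ^ 2 / 2) *
          (Sb ν x - S0 x)
        ≤ ∑' x : ℤ, (1 / 2 * ((x : ℝ) ^ 2 * |S0 x|) + 1 / 2 * (fS x + fM x + fF x)) :=
          Summable.tsum_le_tsum hpt hsdev hmaj2
      _ = 1 / 2 * ∑' x : ℤ, (x : ℝ) ^ 2 * |S0 x| +
            1 / 2 * (∑' x : ℤ, fS x + ∑' x : ℤ, fM x + ∑' x : ℤ, fF x) := by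
          rw [Summable.tsum_add (hsS0.mul_left _) (((hsfS.add hsfM).add hsfF).mul_left _),
            tsum_mul_left, tsum_mul_left, Summable.tsum_add (hsfS.add hsfM) hsfF,
            Summable.tsum_add hsfS hsfM]
      _ ≤ 1 / 2 * Cs + 1 / 2 * (3 * M * R ^ 3 + ∑' x : ℤ, fM x + ∑' x : ℤ, fF x) := by
          linarith [hBstat, hBshort]
  -- the representation of the difference
  have hdiff : Ghν ν k - Ghν ν 0 = ν * ∑' x : ℤ,
      ((1 - Real.cos (k * (x : ℝ))) / (2 - 2 * Real.cos k) - (x : ℝ) ^ 2 / 2) * (Sb ν x - S0 x) := by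
    have hGk : Ghν ν k = ν * (∑' x : ℤ, (1 - Real.cos (k * (x : ℝ))) * (Sb ν x - S0 x)) /
        (2 - 2 * Real.cos k) := by
      rw [eq_div_iff hd.ne', mul_comm]; exact hrep k
    have e : (fun x : ℤ => ((1 - Real.cos (k * (x : ℝ))) / (2 - 2 * Real.cos k) - (x : ℝ) ^ 2 / 2) *
        (Sb ν x - S0 x)) = fun x : ℤ => (2 - 2 * Real.cos k)⁻¹ * ((1 - Real.cos (k * (x : ℝ))) *
          (Sb ν x - S0 x)) - 1 / 2 * ((x : ℝ) ^ 2 * (Sb ν x - S0 x)) := by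
      funext x; ring
    rw [e, Summable.tsum_sub (hsEc.mul_left _) (hsE2.mul_left _), tsum_mul_left, tsum_mul_left,
      hGk, hzero]
    ring
  -- conclusion
  have hfin : Ghν ν k - Ghν ν 0 ≤ ε / 4 + ε / 4 + ε / 8 + ε / 8 := by
    rw [hdiff]
    calc ν * ∑' x : ℤ, ((1 - Real.cos (k * (x : ℝ))) / (2 - 2 * Real.cos k) - (x : ℝ) ^ 2 / 2) *
          (Sb ν x - S0 x)
        ≤ ν * (1 / 2 * Cs + 1 / 2 * (3 * M * R ^ 3 + ∑' x : ℤ, fM x + ∑' x : ℤ, fF x)) :=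
          mul_le_mul_of_nonneg_left hsum_le hν.le
      _ = ν / 2 * Cs + ν / 2 * (3 * M * R ^ 3) + 1 / 2 * (ν * ∑' x : ℤ, fM x) +
            1 / 2 * (ν * ∑' x : ℤ, fF x) := by ring
      _ ≤ ε / 4 + ε / 4 + ε / 8 + ε / 8 := by linarith [hBstat', hBshort', hBmeso, hBfar]
  linarith

end Summit.AtomisticToContinuum.FouriersLaw.Theorems.CornerNoDip.HeatProfile

end
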